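import Literature.Topology.FourManifolds.VertexShear
import Mathlib.Analysis.Calculus.MeanValue
import Mathlib.Analysis.Calculus.Deriv.Inv
import Mathlib.Analysis.Calculus.InverseFunctionTheorem.ApproximatesLinearOn
import Mathlib.Analysis.SpecificLimits.Normed
import HarnessLib

/-!
# Vertex conical shears, II: the derivative bound and global invertibility

Topic `Literature/Topology/FourManifolds`; sequel of `VertexShear.lean` (device for the vertex stage of
the smoothing of PD homeomorphisms, Munkres, Ann. of Math. 72 (1960), §5).  For curves `γ i` whose
displacement from their tangent lines is quadratic, `‖γ i s − s • v i‖ ≤ κ s²` and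
`‖(γ i)' s − v i‖ ≤ κ s` on `[0, 3R]`, the vertex shear satisfies

  `‖D(vertexShear γ v R θ₀) z − I‖ ≤ C(θ₀) · m · κ · R`   (`norm_fderiv_vertexShear_sub_id_le`)

with a constant depending only on the angular width `θ₀ ∈ (0, 1]` (via scaling of the radial
cutoffs: their derivatives are `≤ C/R`; the angular cutoff is differentiated only where the slope is
`≤ 2θ₀`, where the slope function has derivative `≤ 16 θ₀/s ≤ 512 θ₀/R`).  Consequently, for `R`
small the shear approximates the identity in the sense of `ApproximatesLinearOn` with a constant
`< 1`, hence is a homeomorphism of the whole space (`vertexShear_homeomorph`), and every derivative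
is invertible (`exists_hasFDerivAt_equiv_vertexShear`).  Everything is proved; no definitions
besides the homeomorphism packaging; no named facts.

## References

* J. R. Munkres, *Obstructions to the smoothing of piecewise-differentiable homeomorphisms*, Ann.
  of Math. (2) 72 (1960), 521–554, §5. [Munkres1960]
-/

noncomputable section

open Set Function Metric Filter Finset
open scoped Topology ContDiff RealInnerProductSpace BigOperators NNReal

namespace Literature.Topology.FourManifolds

variable {H : Type*} [NormedAddCommGroup H] [InnerProductSpace ℝ H]
variable {m : ℕ} {γ : Fin m → ℝ → H} {v : Fin m → H} {R θ₀ : ℝ}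

/-- `∞ ≠ 0` (bookkeeping). [folklore] -/
private theorem vsb_infty_ne_zero : (∞ : WithTop ℕ∞) ≠ 0 := by
  simp

/-! ### §A Generic derivative norm bounds -/

/-- **Norm of the derivative of a scalar-times-vector product**:
`‖D(ψ • d)(z)‖ ≤ |ψ z| ‖Dd(z)‖ + ‖Dψ(z)‖ ‖d z‖`. [folklore] -/
theorem norm_fderiv_smul_le {ψ : H → ℝ} {d : H → H} {z : H} (hψ : DifferentiableAt ℝ ψ z)
    (hd : DifferentiableAt ℝ d z) :
    ‖fderiv ℝ (fun x => ψ x • d x) z‖ ≤ |ψ z| * ‖fderiv ℝ d z‖ + ‖fderiv ℝ ψ z‖ * ‖d z‖ := by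
  rw [fderiv_fun_smul hψ hd]
  calc ‖ψ z • fderiv ℝ d z + (fderiv ℝ ψ z).smulRight (d z)‖
      ≤ ‖ψ z • fderiv ℝ d z‖ + ‖(fderiv ℝ ψ z).smulRight (d z)‖ := norm_add_le _ _
    _ = |ψ z| * ‖fderiv ℝ d z‖ + ‖fderiv ℝ ψ z‖ * ‖d z‖ := by
        rw [norm_smul, Real.norm_eq_abs, ContinuousLinearMap.norm_smulRight_apply]

/-- Derivative of a scalar function of the axial coordinate: `D(χ ∘ ⟪v i, ·⟫)(z) = χ'(s) ⟪v i, ·⟫`.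
[folklore] -/
theorem hasFDerivAt_comp_shearAxial {χ : ℝ → ℝ} {i : Fin m} {z : H}
    (hχ : DifferentiableAt ℝ χ (shearAxial v i z)) :
    HasFDerivAt (fun x => χ (shearAxial v i x)) (deriv χ (shearAxial v i z) • innerSL ℝ (v i)) z := by
  have h1 : HasFDerivAt (shearAxial v i) (innerSL ℝ (v i)) z := (innerSL ℝ (v i)).hasFDerivAt
  exact hχ.hasDerivAt.comp_hasFDerivAt z h1

/-- `‖D(χ ∘ ⟪v i, ·⟫)(z)‖ ≤ |χ'(s)|` for a unit direction. [folklore] -/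
theorem norm_fderiv_comp_shearAxial_le {χ : ℝ → ℝ} {i : Fin m} {z : H} (hv : ‖v i‖ = 1)
    (hχ : DifferentiableAt ℝ χ (shearAxial v i z)) :
    ‖fderiv ℝ (fun x => χ (shearAxial v i x)) z‖ ≤ |deriv χ (shearAxial v i z)| := by
  rw [(hasFDerivAt_comp_shearAxial hχ).fderiv, norm_smul, Real.norm_eq_abs]
  calc |deriv χ (shearAxial v i z)| * ‖innerSL ℝ (v i)‖ ≤ |deriv χ (shearAxial v i z)| * 1 := by
        apply mul_le_mul_of_nonneg_left _ (abs_nonneg _)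
        rw [innerSL_apply_norm, hv]
    _ = |deriv χ (shearAxial v i z)| := mul_one _

/-- Derivative of a vector function of the axial coordinate:
`D(φ ∘ ⟪v i, ·⟫)(z) = ⟪v i, ·⟫ ⊗ φ'(s)`. [folklore] -/
theorem hasFDerivAt_comp_shearAxial' {φ : ℝ → H} {i : Fin m} {z : H}
    (hφ : DifferentiableAt ℝ φ (shearAxial v i z)) :
    HasFDerivAt (fun x => φ (shearAxial v i x)) ((innerSL ℝ (v i)).smulRight (deriv φ (shearAxial v i z))) z := by
  have h1 : HasFDerivAt (shearAxial v i) (innerSL ℝ (v i)) z := (innerSL ℝ (v i)).hasFDerivAt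
  have h2 := hφ.hasDerivAt.hasFDerivAt.comp z h1
  refine h2.congr_fderiv (ContinuousLinearMap.ext fun w => ?_)
  simp [ContinuousLinearMap.smulRight_apply]

/-! ### §B The pieces -/

/-- **The displacement and its derivative**: with `s = ⟪v i, z⟫`,
`shearDisp γ v i z = γ i s − s • v i` and `‖D(shearDisp)(z)‖ ≤ ‖(γ i)' s − v i‖` (unit `v i`).
[folklore] -/
theorem norm_fderiv_shearDisp_le {i : Fin m} {z : H} (hv : ‖v i‖ = 1) (hγ : Differentiable ℝ (γ i)) :
    ‖fderiv ℝ (shearDisp γ v i) z‖ ≤ ‖deriv (γ i) (shearAxial v i z) - v i‖ := by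
  set s := shearAxial v i z with hs
  have hφ : DifferentiableAt ℝ (fun t : ℝ => γ i t - t • v i) s :=
    (hγ s).sub ((differentiableAt_id).smul_const _)
  have hd : deriv (fun t : ℝ => γ i t - t • v i) s = deriv (γ i) s - v i := by
    have h1 : HasDerivAt (fun t : ℝ => t • v i) (v i) s := by
      simpa using (hasDerivAt_id s).smul_const (v i)
    exact ((hγ s).hasDerivAt.sub h1).deriv
  have h := hasFDerivAt_comp_shearAxial' (v := v) (i := i) (z := z) hφ
  have hfun : (fun x => (fun t : ℝ => γ i t - t • v i) (shearAxial v i x)) = shearDisp γ v i := rfl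
  rw [hfun] at h
  rw [h.fderiv, ContinuousLinearMap.norm_smulRight_apply, innerSL_apply_norm, hv, one_mul, ← hs, hd]

/-- Scaling of the radial plateau: `shearRadial R s = shearRadial 1 (s / R)`. [folklore] -/
theorem shearRadial_scale (hR : 0 < R) (s : ℝ) : shearRadial R s = shearRadial 1 (s / R) := by
  have hsc : ∀ a b : ℝ, rampCutoff (R * a) (R * b) s = rampCutoff a b (s / R) := by
    intro a b
    unfold rampCutoff
    congr 1
    rw [← mul_div_cancel₀ s hR.ne'] 
    rw [show R * (s / R) = s by field_simp]
    field_simp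
  rw [shearRadial, shearRadial]
  rw [show R / 32 = R * (1 / 32) by ring, show R / 16 = R * (1 / 16) by ring,
    show 2 * R = R * (2 * 1) by ring, show 3 * R = R * (3 * 1) by ring, hsc, hsc]

/-- **A universal bound `C/R` for the derivative of the radial plateau.** [folklore] -/
theorem exists_deriv_shearRadial_bound :
    ∃ C : ℝ, 0 ≤ C ∧ ∀ R : ℝ, 0 < R → ∀ s : ℝ, |deriv (shearRadial R) s| ≤ C / R := by
  obtain ⟨Cf, hCf0, hCf⟩ := exists_deriv_rampCutoff_bound (a := (1 : ℝ) / 32) (b := 1 / 16) (by norm_num)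
  obtain ⟨Cg, hCg0, hCg⟩ := exists_deriv_rampCutoff_bound (a := 2 * (1 : ℝ)) (b := 3 * 1) (by norm_num)
  -- derivative of the unit plateau
  set f : ℝ → ℝ := rampCutoff (1 / 32) (1 / 16) with hf
  set g : ℝ → ℝ := rampCutoff (2 * 1) (3 * 1) with hg
  have hfd : Differentiable ℝ f := (contDiff_rampCutoff _ _).differentiable (by simp)
  have hgd : Differentiable ℝ g := (contDiff_rampCutoff _ _).differentiable (by simp)
  have hunit : ∀ t, |deriv (shearRadial 1) t| ≤ Cf / (1 / 16 - 1 / 32) + Cg / (3 * 1 - 2 * 1) := by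
    intro t
    have hfun : shearRadial 1 = fun t => f t * (1 - g t) := by
      funext t; simp [shearRadial, hf, hg]
    have hder : HasDerivAt (shearRadial 1) (deriv f t * (1 - g t) + f t * (-deriv g t)) t := by
      rw [hfun]
      exact (hfd t).hasDerivAt.mul ((hgd t).hasDerivAt.const_sub 1)
    rw [hder.deriv]
    have hf1 := rampCutoff_mem_Icc (1 / 32) (1 / 16) t
    have hg1 := rampCutoff_mem_Icc (2 * 1) (3 * 1) t
    have h1 : |deriv f t * (1 - g t)| ≤ Cf / (1 / 16 - 1 / 32) := by
      rw [abs_mul, abs_of_nonneg (hCf t).1, abs_of_nonneg (by linarith [hg1.2] : (0 : ℝ) ≤ 1 - g t)]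
      calc deriv f t * (1 - g t) ≤ Cf / (1 / 16 - 1 / 32) * 1 :=
            mul_le_mul (hCf t).2 (by linarith [hg1.1]) (by linarith [hg1.2]) (div_nonneg hCf0 (by norm_num))
        _ = Cf / (1 / 16 - 1 / 32) := mul_one _
    have h2 : |f t * -deriv g t| ≤ Cg / (3 * 1 - 2 * 1) := by
      rw [abs_mul, abs_neg, abs_of_nonneg hf1.1, abs_of_nonneg (hCg t).1]
      calc f t * deriv g t ≤ 1 * (Cg / (3 * 1 - 2 * 1)) :=
            mul_le_mul hf1.2 (hCg t).2 (hCg t).1 zero_le_one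
        _ = Cg / (3 * 1 - 2 * 1) := one_mul _
    exact (abs_add_le _ _).trans (add_le_add h1 h2)
  refine ⟨Cf / (1 / 16 - 1 / 32) + Cg / (3 * 1 - 2 * 1), by positivity, fun R hR s => ?_⟩
  -- scale
  have hfun : shearRadial R = fun s => shearRadial 1 (s / R) := funext (shearRadial_scale hR)
  have hd1 : Differentiable ℝ (shearRadial 1) :=
    (contDiff_shearRadial 1).differentiable (by simp)
  have hder : HasDerivAt (shearRadial R) (deriv (shearRadial 1) (s / R) * (1 / R)) s := by
    rw [hfun]
    exact (hd1 _).hasDerivAt.comp s ((hasDerivAt_id s).div_const R)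
  rw [hder.deriv, abs_mul, abs_of_pos (by positivity : (0 : ℝ) < 1 / R), mul_one_div]
  exact div_le_div_of_nonneg_right (hunit _) hR.le

/-- **A bound for the derivative of the angular cutoff** (depending on `θ₀`). [folklore] -/
theorem exists_deriv_shearAngular_bound (hθ : 0 < θ₀) :
    ∃ C : ℝ, 0 ≤ C ∧ ∀ ρ : ℝ, |deriv (shearAngular θ₀) ρ| ≤ C := by
  obtain ⟨C, hC0, hC⟩ := exists_deriv_rampCutoff_bound (a := θ₀ ^ 2) (b := 4 * θ₀ ^ 2) (by nlinarith)
  refine ⟨C / (4 * θ₀ ^ 2 - θ₀ ^ 2), div_nonneg hC0 (by nlinarith), fun ρ => ?_⟩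
  have hd : Differentiable ℝ (rampCutoff (θ₀ ^ 2) (4 * θ₀ ^ 2)) :=
    (contDiff_rampCutoff _ _).differentiable (by simp)
  have hder : HasDerivAt (shearAngular θ₀) (-deriv (rampCutoff (θ₀ ^ 2) (4 * θ₀ ^ 2)) ρ) ρ := by
    have := (hd ρ).hasDerivAt.const_sub 1
    exact this
  rw [hder.deriv, abs_neg, abs_of_nonneg (hC ρ).1]
  exact (hC ρ).2

/-- **The slope function and its derivative.** With `s = ⟪v i, z⟫ ≠ 0` and `w = shearTrans v i z`,
the squared slope `q z = ‖w‖² / s²` is differentiable at `z` and, when `0 < s`, `‖w‖ ≤ 2 θ₀ s`,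
`θ₀ ≤ 1`, `‖v i‖ = 1`: `‖Dq(z)‖ ≤ 16 θ₀ / s`. [folklore] -/
theorem norm_fderiv_slope_le {i : Fin m} {z : H} (hv : ‖v i‖ = 1) (hθ1 : θ₀ ≤ 1)
    (hs : 0 < shearAxial v i z) (hw : ‖shearTrans v i z‖ ≤ 2 * θ₀ * shearAxial v i z) :
    ‖fderiv ℝ (fun x => ‖shearTrans v i x‖ ^ 2 / shearAxial v i x ^ 2) z‖ ≤ 16 * θ₀ / shearAxial v i z := by
  set s := shearAxial v i z with hsdef
  set w := shearTrans v i z with hwdef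
  have hθ0 : 0 ≤ θ₀ := by
    have : 0 ≤ 2 * θ₀ * s := (norm_nonneg _).trans hw
    nlinarith
  -- derivatives of the pieces
  have hA : HasFDerivAt (shearAxial v i) (innerSL ℝ (v i)) z := (innerSL ℝ (v i)).hasFDerivAt
  have hT : HasFDerivAt (shearTrans v i)
      (ContinuousLinearMap.id ℝ H - (innerSL ℝ (v i)).smulRight (v i)) z := by
    have := (hasFDerivAt_id z).sub (hA.smul_const (v i))
    exact this
  have hN : HasFDerivAt (fun x => ‖shearTrans v i x‖ ^ 2)
      (2 • (innerSL ℝ w).comp (ContinuousLinearMap.id ℝ H - (innerSL ℝ (v i)).smulRight (v i))) z :=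
    hT.norm_sq
  have hD : HasFDerivAt (fun x => shearAxial v i x ^ 2) ((2 * s) • innerSL ℝ (v i)) z := by
    have := hA.pow 2
    simpa [← hsdef, pow_one] using this
  -- `q = N · D⁻¹`
  have hDinv : HasFDerivAt (fun x => (shearAxial v i x ^ 2)⁻¹) ((-((s ^ 2) ^ 2)⁻¹) • ((2 * s) • innerSL ℝ (v i))) z :=
    (hasDerivAt_inv (pow_ne_zero 2 hs.ne')).comp_hasFDerivAt z hD
  have hq : HasFDerivAt (fun x => ‖shearTrans v i x‖ ^ 2 / shearAxial v i x ^ 2)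
      (‖w‖ ^ 2 • ((-((s ^ 2) ^ 2)⁻¹) • ((2 * s) • innerSL ℝ (v i))) +
        (s ^ 2)⁻¹ • (2 • (innerSL ℝ w).comp (ContinuousLinearMap.id ℝ H - (innerSL ℝ (v i)).smulRight (v i)))) z := by
    have := hN.mul hDinv
    exact this.congr_of_eventuallyEq (Filter.Eventually.of_forall fun x => div_eq_mul_inv _ _)
  rw [hq.fderiv]
  -- norms of the pieces
  have hTnorm : ‖ContinuousLinearMap.id ℝ H - (innerSL ℝ (v i)).smulRight (v i)‖ ≤ 2 := by
    calc ‖ContinuousLinearMap.id ℝ H - (innerSL ℝ (v i)).smulRight (v i)‖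
        ≤ ‖ContinuousLinearMap.id ℝ H‖ + ‖(innerSL ℝ (v i)).smulRight (v i)‖ := norm_sub_le _ _
      _ ≤ 1 + 1 := by
          apply add_le_add ContinuousLinearMap.norm_id_le
          rw [ContinuousLinearMap.norm_smulRight_apply, innerSL_apply_norm, hv, mul_one]
      _ = 2 := by norm_num
  have hcomp : ‖(innerSL ℝ w).comp (ContinuousLinearMap.id ℝ H - (innerSL ℝ (v i)).smulRight (v i))‖
      ≤ ‖w‖ * 2 := by
    calc _ ≤ ‖innerSL ℝ w‖ * ‖ContinuousLinearMap.id ℝ H - (innerSL ℝ (v i)).smulRight (v i)‖ :=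
          ContinuousLinearMap.opNorm_comp_le _ _
      _ ≤ ‖w‖ * 2 := by
          rw [innerSL_apply_norm]; exact mul_le_mul_of_nonneg_left hTnorm (norm_nonneg _)
  have hNnorm : ‖(2 : ℕ) • (innerSL ℝ w).comp (ContinuousLinearMap.id ℝ H - (innerSL ℝ (v i)).smulRight (v i))‖
      ≤ 4 * ‖w‖ := by
    rw [two_nsmul]
    calc _ ≤ ‖(innerSL ℝ w).comp (ContinuousLinearMap.id ℝ H - (innerSL ℝ (v i)).smulRight (v i))‖ +
          ‖(innerSL ℝ w).comp (ContinuousLinearMap.id ℝ H - (innerSL ℝ (v i)).smulRight (v i))‖ :=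
          norm_add_le _ _
      _ ≤ ‖w‖ * 2 + ‖w‖ * 2 := add_le_add hcomp hcomp
      _ = 4 * ‖w‖ := by ring
  have hDnorm : ‖(2 * s) • innerSL ℝ (v i)‖ ≤ 2 * s := by
    rw [norm_smul, Real.norm_eq_abs, abs_of_pos (by positivity), innerSL_apply_norm, hv, mul_one]
  have hs2 : (0 : ℝ) < s ^ 2 := by positivity
  -- first term: `‖w‖² (s⁴)⁻¹ 2s`, second: `(s²)⁻¹ 4‖w‖`
  have h1 : ‖‖w‖ ^ 2 • ((-((s ^ 2) ^ 2)⁻¹) • ((2 * s) • innerSL ℝ (v i)))‖ ≤ 2 * ‖w‖ ^ 2 / s ^ 3 := by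
    rw [norm_smul, norm_smul, Real.norm_eq_abs, abs_of_nonneg (sq_nonneg ‖w‖), Real.norm_eq_abs, abs_neg,
      abs_of_nonneg (by positivity : (0 : ℝ) ≤ ((s ^ 2) ^ 2)⁻¹)]
    calc ‖w‖ ^ 2 * (((s ^ 2) ^ 2)⁻¹ * ‖(2 * s) • innerSL ℝ (v i)‖) ≤ ‖w‖ ^ 2 * (((s ^ 2) ^ 2)⁻¹ * (2 * s)) :=
          mul_le_mul_of_nonneg_left (mul_le_mul_of_nonneg_left hDnorm (by positivity)) (sq_nonneg _)
      _ = 2 * ‖w‖ ^ 2 / s ^ 3 := by field_simp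
  have h2 : ‖(s ^ 2)⁻¹ • ((2 : ℕ) • (innerSL ℝ w).comp
      (ContinuousLinearMap.id ℝ H - (innerSL ℝ (v i)).smulRight (v i)))‖ ≤ 4 * ‖w‖ / s ^ 2 := by
    rw [norm_smul, Real.norm_eq_abs, abs_of_pos (by positivity)]
    calc (s ^ 2)⁻¹ * _ ≤ (s ^ 2)⁻¹ * (4 * ‖w‖) := mul_le_mul_of_nonneg_left hNnorm (by positivity)
      _ = 4 * ‖w‖ / s ^ 2 := by field_simp
  calc ‖‖w‖ ^ 2 • ((-((s ^ 2) ^ 2)⁻¹) • ((2 * s) • innerSL ℝ (v i))) +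
        (s ^ 2)⁻¹ • ((2 : ℕ) • (innerSL ℝ w).comp (ContinuousLinearMap.id ℝ H - (innerSL ℝ (v i)).smulRight (v i)))‖
      ≤ 2 * ‖w‖ ^ 2 / s ^ 3 + 4 * ‖w‖ / s ^ 2 := (norm_add_le _ _).trans (add_le_add h1 h2)
    _ ≤ 2 * (2 * θ₀ * s) ^ 2 / s ^ 3 + 4 * (2 * θ₀ * s) / s ^ 2 := by
        have h3 : 2 * ‖w‖ ^ 2 / s ^ 3 ≤ 2 * (2 * θ₀ * s) ^ 2 / s ^ 3 :=
          div_le_div_of_nonneg_right (by nlinarith [norm_nonneg w, pow_le_pow_left₀ (norm_nonneg w) hw 2])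
            (by positivity)
        have h4 : 4 * ‖w‖ / s ^ 2 ≤ 4 * (2 * θ₀ * s) / s ^ 2 :=
          div_le_div_of_nonneg_right (by linarith) hs2.le
        exact add_le_add h3 h4
    _ = (8 * θ₀ ^ 2 + 8 * θ₀) / s := by
        field_simp
        ring
    _ ≤ 16 * θ₀ / s := by
        apply div_le_div_of_nonneg_right _ hs.le
        nlinarith

/-! ### §B6–B8 The weight, the terms, the sum -/

/-- A function vanishing on a neighbourhood has zero derivative there. [folklore] -/
theorem fderiv_eq_zero_of_eventuallyEq_zero {E' : Type*} [NormedAddCommGroup E'] [NormedSpace ℝ E']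
    {f : H → E'} {z : H} (h : f =ᶠ[𝓝 z] fun _ => 0) : fderiv ℝ f z = 0 := by
  rw [h.fderiv_eq]; exact fderiv_const_apply 0

/-- Below the radial threshold the weight vanishes identically near the point. [folklore] -/
theorem shearWeight_eventuallyEq_zero_of_lt (hR : 0 < R) {i : Fin m} {z : H}
    (hs : shearAxial v i z < R / 32) : shearWeight v R θ₀ i =ᶠ[𝓝 z] fun _ => 0 := by
  have ho : IsOpen {x : H | shearAxial v i x < R / 32} :=
    isOpen_lt (contDiff_shearAxial v i).continuous continuous_const
  filter_upwards [ho.mem_nhds hs] with x hx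
  rw [shearWeight, shearRadial_eq_zero_of_le hR (le_of_lt hx), zero_mul]

/-- Above the radial range the weight vanishes identically near the point. [folklore] -/
theorem shearWeight_eventuallyEq_zero_of_gt (hR : 0 < R) {i : Fin m} {z : H}
    (hs : 3 * R < shearAxial v i z) : shearWeight v R θ₀ i =ᶠ[𝓝 z] fun _ => 0 := by
  have ho : IsOpen {x : H | 3 * R < shearAxial v i x} :=
    isOpen_lt continuous_const (contDiff_shearAxial v i).continuous
  filter_upwards [ho.mem_nhds hs] with x hx
  rw [shearWeight, shearRadial_eq_zero_of_ge hR (le_of_lt hx), zero_mul]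

/-- **The derivative of the shear weight is `≤ (512 θ₀ C_A + C_rad)/R`** everywhere, given the
cutoff derivative bounds `|shearRadial'| ≤ C_rad/R`, `|shearAngular'| ≤ C_A` (`0 < θ₀ ≤ 1`, unit
`v i`, `R > 0`). [folklore] -/
theorem norm_fderiv_shearWeight_le (hR : 0 < R) (hθ : 0 < θ₀) (hθ1 : θ₀ ≤ 1) {i : Fin m} (hv : ‖v i‖ = 1)
    {Crad CA : ℝ} (hCA0 : 0 ≤ CA) (hCrad : ∀ s, |deriv (shearRadial R) s| ≤ Crad / R)
    (hCAb : ∀ ρ, |deriv (shearAngular θ₀) ρ| ≤ CA) (z : H) :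
    ‖fderiv ℝ (shearWeight v R θ₀ i) z‖ ≤ (512 * θ₀ * CA + Crad) / R := by
  have hCrad0 : 0 ≤ Crad / R := (abs_nonneg _).trans (hCrad 0)
  have hbound0 : 0 ≤ (512 * θ₀ * CA + Crad) / R := by
    rw [add_div]; exact add_nonneg (by positivity) hCrad0
  set sz := shearAxial v i z with hsz
  by_cases hs : sz < R / 32
  · rw [fderiv_eq_zero_of_eventuallyEq_zero (shearWeight_eventuallyEq_zero_of_lt hR hs), norm_zero]
    exact hbound0
  have hs0 : 0 < sz := lt_of_lt_of_le (by linarith) (not_lt.1 hs)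
  have hsR : R / 32 ≤ sz := not_lt.1 hs
  -- the two factors
  set qf : H → ℝ := fun x => ‖shearTrans v i x‖ ^ 2 / shearAxial v i x ^ 2 with hqf
  have hq_diff : DifferentiableAt ℝ qf z :=
    (((contDiff_shearTrans v i).contDiffAt.norm_sq ℝ).div ((contDiff_shearAxial v i).contDiffAt.pow 2)
      (pow_ne_zero 2 hs0.ne')).differentiableAt (by simp : (∞ : WithTop ℕ∞) ≠ 0)
  have hrad_d : Differentiable ℝ (shearRadial R) := (contDiff_shearRadial R).differentiable (by simp)
  have hang_d : Differentiable ℝ (shearAngular θ₀) := (contDiff_shearAngular θ₀).differentiable (by simp)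
  have hf1 : HasFDerivAt (fun x => shearRadial R (shearAxial v i x))
      (deriv (shearRadial R) sz • innerSL ℝ (v i)) z := hasFDerivAt_comp_shearAxial (hrad_d sz)
  have hf2 : HasFDerivAt (fun x => shearAngular θ₀ (qf x))
      (deriv (shearAngular θ₀) (qf z) • fderiv ℝ qf z) z :=
    (hang_d _).hasDerivAt.comp_hasFDerivAt z hq_diff.hasFDerivAt
  have hprod := hf1.mul hf2
  rw [show ((fun x => shearRadial R (shearAxial v i x)) * fun x => shearAngular θ₀ (qf x)) =
      shearWeight v R θ₀ i from rfl] at hprod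
  rw [hprod.fderiv]
  have hw1 := shearRadial_mem_Icc R sz
  have hw2 := shearAngular_mem_Icc θ₀ (qf z)
  -- second term: `shearAngular • (shearRadial' • innerSL)`
  have hterm2 : ‖shearAngular θ₀ (qf z) • (deriv (shearRadial R) sz • innerSL ℝ (v i))‖ ≤ Crad / R := by
    rw [norm_smul, norm_smul, Real.norm_eq_abs, Real.norm_eq_abs, abs_of_nonneg hw2.1, innerSL_apply_norm, hv,
      mul_one]
    calc shearAngular θ₀ (qf z) * |deriv (shearRadial R) sz| ≤ 1 * (Crad / R) :=
          mul_le_mul hw2.2 (hCrad sz) (abs_nonneg _) zero_le_one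
      _ = Crad / R := one_mul _
  -- first term: `shearRadial • (shearAngular' • Dq)`
  have hterm1 : ‖shearRadial R sz • (deriv (shearAngular θ₀) (qf z) • fderiv ℝ qf z)‖ ≤ 512 * θ₀ * CA / R := by
    by_cases hq4 : 4 * θ₀ ^ 2 < qf z
    · -- the angular cutoff is locally constant (zero): its derivative term vanishes
      have hev : (fun x => shearAngular θ₀ (qf x)) =ᶠ[𝓝 z] fun _ => 0 := by
        filter_upwards [hq_diff.continuousAt.preimage_mem_nhds (Ioi_mem_nhds hq4)] with x hx
        exact shearAngular_eq_zero hθ (le_of_lt hx)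
      have h0 : deriv (shearAngular θ₀) (qf z) • fderiv ℝ qf z = 0 :=
        hf2.unique ((hasFDerivAt_const (0 : ℝ) z).congr_of_eventuallyEq hev)
      rw [h0, smul_zero, norm_zero]; positivity
    · -- slope `≤ 2θ₀`: the slope derivative is `≤ 16θ₀/s ≤ 512θ₀/R`
      have hq4' : qf z ≤ 4 * θ₀ ^ 2 := not_lt.1 hq4
      have hw : ‖shearTrans v i z‖ ≤ 2 * θ₀ * sz := by
        have h1 : ‖shearTrans v i z‖ ^ 2 ≤ (2 * θ₀ * sz) ^ 2 := by
          have h := hq4'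
          simp only [hqf] at h
          rw [div_le_iff₀ (by positivity)] at h
          nlinarith
        exact (pow_le_pow_iff_left₀ (norm_nonneg _) (by positivity) two_ne_zero).1 h1
      have hDq : ‖fderiv ℝ qf z‖ ≤ 16 * θ₀ / sz := norm_fderiv_slope_le hv hθ1 hs0 hw
      have hDq' : ‖fderiv ℝ qf z‖ ≤ 512 * θ₀ / R := by
        refine hDq.trans ?_
        rw [div_le_div_iff₀ hs0 hR]
        nlinarith [hθ.le]
      rw [norm_smul, norm_smul, Real.norm_eq_abs, Real.norm_eq_abs, abs_of_nonneg hw1.1]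
      calc shearRadial R sz * (|deriv (shearAngular θ₀) (qf z)| * ‖fderiv ℝ qf z‖)
          ≤ 1 * (CA * (512 * θ₀ / R)) :=
            mul_le_mul hw1.2 (mul_le_mul (hCAb _) hDq' (norm_nonneg _) hCA0)
              (mul_nonneg (abs_nonneg _) (norm_nonneg _)) zero_le_one
        _ = 512 * θ₀ * CA / R := by ring
  calc ‖shearRadial R sz • (deriv (shearAngular θ₀) (qf z) • fderiv ℝ qf z) +
        shearAngular θ₀ (qf z) • (deriv (shearRadial R) sz • innerSL ℝ (v i))‖
      ≤ 512 * θ₀ * CA / R + Crad / R := (norm_add_le _ _).trans (add_le_add hterm1 hterm2)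
    _ = (512 * θ₀ * CA + Crad) / R := by ring

/-- **The derivative of one shear term** `z ↦ shearWeight i z • shearDisp i z` is
`≤ κ R (3 + 9 (512 θ₀ C_A + C_rad))`, given the quadratic displacement bounds of the curve on
`[0, 3R]`. [folklore] -/
theorem norm_fderiv_shearTerm_le (hR : 0 < R) (hθ : 0 < θ₀) (hθ1 : θ₀ ≤ 1) {i : Fin m} (hv : ‖v i‖ = 1)
    (hγ : ContDiff ℝ ∞ (γ i)) {κ : ℝ} (hκ : 0 ≤ κ)
    (hd0 : ∀ s : ℝ, 0 ≤ s → s ≤ 3 * R → ‖γ i s - s • v i‖ ≤ κ * s ^ 2)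
    (hd1 : ∀ s : ℝ, 0 ≤ s → s ≤ 3 * R → ‖deriv (γ i) s - v i‖ ≤ κ * s)
    {Crad CA : ℝ} (hCA0 : 0 ≤ CA) (hCrad : ∀ s, |deriv (shearRadial R) s| ≤ Crad / R)
    (hCAb : ∀ ρ, |deriv (shearAngular θ₀) ρ| ≤ CA) (z : H) :
    ‖fderiv ℝ (fun x => shearWeight v R θ₀ i x • shearDisp γ v i x) z‖ ≤
      κ * R * (3 + 9 * (512 * θ₀ * CA + Crad)) := by
  have hCrad0 : 0 ≤ Crad := by
    have := (abs_nonneg _).trans (hCrad 0)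
    rwa [le_div_iff₀ hR, zero_mul] at this
  have hK0 : 0 ≤ κ * R * (3 + 9 * (512 * θ₀ * CA + Crad)) := by positivity
  set sz := shearAxial v i z with hsz
  -- outside the radial range the term is locally zero
  by_cases hs : sz < R / 32
  · have hev : (fun x => shearWeight v R θ₀ i x • shearDisp γ v i x) =ᶠ[𝓝 z] fun _ => 0 := by
      filter_upwards [shearWeight_eventuallyEq_zero_of_lt (θ₀ := θ₀) hR hs] with x hx
      rw [hx, zero_smul]
    rw [fderiv_eq_zero_of_eventuallyEq_zero hev, norm_zero]; exact hK0
  by_cases hs' : 3 * R < sz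
  · have hev : (fun x => shearWeight v R θ₀ i x • shearDisp γ v i x) =ᶠ[𝓝 z] fun _ => 0 := by
      filter_upwards [shearWeight_eventuallyEq_zero_of_gt (θ₀ := θ₀) hR hs'] with x hx
      rw [hx, zero_smul]
    rw [fderiv_eq_zero_of_eventuallyEq_zero hev, norm_zero]; exact hK0
  have hs0 : 0 ≤ sz := le_trans (by linarith) (not_lt.1 hs)
  have hs3 : sz ≤ 3 * R := not_lt.1 hs'
  -- the product bound
  have hψd : DifferentiableAt ℝ (shearWeight v R θ₀ i) z :=
    (contDiff_shearWeight hR i).differentiable (by simp) z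
  have hdd : DifferentiableAt ℝ (shearDisp γ v i) z := (contDiff_shearDisp hγ).differentiable (by simp) z
  refine (norm_fderiv_smul_le hψd hdd).trans ?_
  have h1 : |shearWeight v R θ₀ i z| ≤ 1 := by
    have h := shearWeight_mem_Icc (v := v) (R := R) (θ₀ := θ₀) i z
    rw [abs_of_nonneg h.1]; exact h.2
  have h2 : ‖fderiv ℝ (shearDisp γ v i) z‖ ≤ κ * (3 * R) := by
    refine (norm_fderiv_shearDisp_le hv (hγ.differentiable (by simp))).trans ?_
    exact (hd1 sz hs0 hs3).trans (mul_le_mul_of_nonneg_left hs3 hκ)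
  have h3 : ‖fderiv ℝ (shearWeight v R θ₀ i) z‖ ≤ (512 * θ₀ * CA + Crad) / R :=
    norm_fderiv_shearWeight_le hR hθ hθ1 hv hCA0 hCrad hCAb z
  have h4 : ‖shearDisp γ v i z‖ ≤ κ * (3 * R) ^ 2 := by
    have := hd0 sz hs0 hs3
    refine le_trans this (mul_le_mul_of_nonneg_left ?_ hκ)
    exact pow_le_pow_left₀ hs0 hs3 2
  have hC0 : 0 ≤ (512 * θ₀ * CA + Crad) / R := by positivity
  calc |shearWeight v R θ₀ i z| * ‖fderiv ℝ (shearDisp γ v i) z‖ +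
        ‖fderiv ℝ (shearWeight v R θ₀ i) z‖ * ‖shearDisp γ v i z‖
      ≤ 1 * (κ * (3 * R)) + (512 * θ₀ * CA + Crad) / R * (κ * (3 * R) ^ 2) :=
        add_le_add (mul_le_mul h1 h2 (norm_nonneg _) zero_le_one) (mul_le_mul h3 h4 (norm_nonneg _) hC0)
    _ = κ * R * (3 + 9 * (512 * θ₀ * CA + Crad)) := by
        field_simp
        ring

/-- **The derivative of the vertex shear is close to the identity**:
`‖D(vertexShear)(z) − I‖ ≤ m κ R (3 + 9(512 θ₀ C_A + C_rad))`. [folklore] -/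
theorem norm_fderiv_vertexShear_sub_id_le (hR : 0 < R) (hθ : 0 < θ₀) (hθ1 : θ₀ ≤ 1) (hv : ∀ i, ‖v i‖ = 1)
    (hγ : ∀ i, ContDiff ℝ ∞ (γ i)) {κ : ℝ} (hκ : 0 ≤ κ)
    (hd0 : ∀ i (s : ℝ), 0 ≤ s → s ≤ 3 * R → ‖γ i s - s • v i‖ ≤ κ * s ^ 2)
    (hd1 : ∀ i (s : ℝ), 0 ≤ s → s ≤ 3 * R → ‖deriv (γ i) s - v i‖ ≤ κ * s)
    {Crad CA : ℝ} (hCA0 : 0 ≤ CA) (hCrad : ∀ s, |deriv (shearRadial R) s| ≤ Crad / R)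
    (hCAb : ∀ ρ, |deriv (shearAngular θ₀) ρ| ≤ CA) (z : H) :
    ‖fderiv ℝ (vertexShear γ v R θ₀) z - ContinuousLinearMap.id ℝ H‖ ≤
      m * (κ * R * (3 + 9 * (512 * θ₀ * CA + Crad))) := by
  -- derivative of the sum
  have hterm : ∀ i, DifferentiableAt ℝ (fun x => shearWeight v R θ₀ i x • shearDisp γ v i x) z := fun i =>
    ((contDiff_shearWeight hR i).differentiable (by simp) z).smul
      ((contDiff_shearDisp (hγ i)).differentiable (by simp) z)
  have hsum : HasFDerivAt (fun x => ∑ i, shearWeight v R θ₀ i x • shearDisp γ v i x)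
      (∑ i, fderiv ℝ (fun x => shearWeight v R θ₀ i x • shearDisp γ v i x) z) z :=
    HasFDerivAt.fun_sum fun i _ => (hterm i).hasFDerivAt
  have hΘ : HasFDerivAt (vertexShear γ v R θ₀)
      (ContinuousLinearMap.id ℝ H + ∑ i, fderiv ℝ (fun x => shearWeight v R θ₀ i x • shearDisp γ v i x) z) z :=
    (hasFDerivAt_id z).add hsum
  rw [hΘ.fderiv, add_sub_cancel_left]
  calc ‖∑ i, fderiv ℝ (fun x => shearWeight v R θ₀ i x • shearDisp γ v i x) z‖
      ≤ ∑ i, ‖fderiv ℝ (fun x => shearWeight v R θ₀ i x • shearDisp γ v i x) z‖ := norm_sum_le _ _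
    _ ≤ ∑ _i : Fin m, κ * R * (3 + 9 * (512 * θ₀ * CA + Crad)) :=
        Finset.sum_le_sum fun i _ =>
          norm_fderiv_shearTerm_le hR hθ hθ1 (hv i) (hγ i) hκ (hd0 i) (hd1 i) hCA0 hCrad hCAb z
    _ = m * (κ * R * (3 + 9 * (512 * θ₀ * CA + Crad))) := by
        rw [Finset.sum_const, Finset.card_univ, Fintype.card_fin, nsmul_eq_mul]

/-- **Packaged form with a constant depending only on `θ₀`**: there is `C(θ₀) ≥ 0` such that for
every radius `R > 0` and every family of curves with quadratic displacement bounds of constant `κ`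
on `[0, 3R]`, `‖D(vertexShear)(z) − I‖ ≤ C(θ₀) · m · κ · R` for all `z`. [folklore] -/
theorem exists_vertexShear_fderiv_const (hθ : 0 < θ₀) (hθ1 : θ₀ ≤ 1) :
    ∃ C : ℝ, 0 ≤ C ∧ ∀ (R : ℝ), 0 < R → ∀ (m : ℕ) (γ : Fin m → ℝ → H) (v : Fin m → H) (κ : ℝ),
      (∀ i, ‖v i‖ = 1) → (∀ i, ContDiff ℝ ∞ (γ i)) → 0 ≤ κ →
      (∀ i (s : ℝ), 0 ≤ s → s ≤ 3 * R → ‖γ i s - s • v i‖ ≤ κ * s ^ 2) →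
      (∀ i (s : ℝ), 0 ≤ s → s ≤ 3 * R → ‖deriv (γ i) s - v i‖ ≤ κ * s) →
      ∀ z : H, ‖fderiv ℝ (vertexShear γ v R θ₀) z - ContinuousLinearMap.id ℝ H‖ ≤ C * m * κ * R := by
  obtain ⟨Crad, hCrad0, hCrad⟩ := exists_deriv_shearRadial_bound
  obtain ⟨CA, hCA0, hCA⟩ := exists_deriv_shearAngular_bound (θ₀ := θ₀) hθ
  refine ⟨3 + 9 * (512 * θ₀ * CA + Crad), by positivity, ?_⟩
  intro R hR m γ v κ hv hγ hκ hd0 hd1 z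
  have h := norm_fderiv_vertexShear_sub_id_le hR hθ hθ1 hv hγ hκ hd0 hd1 hCA0 (hCrad R hR) hCA z
  calc _ ≤ m * (κ * R * (3 + 9 * (512 * θ₀ * CA + Crad))) := h
    _ = (3 + 9 * (512 * θ₀ * CA + Crad)) * m * κ * R := by ring

/-! ### §C Global invertibility -/

/-- **The vertex shear approximates the identity** in the sense of `ApproximatesLinearOn` on the
whole space, with the constant bounding `‖D(vertexShear) − I‖` (mean value inequality).
[folklore] -/
theorem approximatesLinearOn_vertexShear (hR : 0 < R) (hγ : ∀ i, ContDiff ℝ ∞ (γ i)) {c : ℝ≥0}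
    (hc : ∀ z : H, ‖fderiv ℝ (vertexShear γ v R θ₀) z - ContinuousLinearMap.id ℝ H‖ ≤ c) :
    ApproximatesLinearOn (vertexShear γ v R θ₀)
      ((ContinuousLinearEquiv.refl ℝ H : H ≃L[ℝ] H) : H →L[ℝ] H) univ c := by
  intro x _ y _
  -- mean value inequality for `g = vertexShear − id`
  have hdiff : Differentiable ℝ (vertexShear γ v R θ₀) := (contDiff_vertexShear hR hγ).differentiable (by simp)
  set g : H → H := fun z => vertexShear γ v R θ₀ z - z with hg
  have hgd : ∀ z, HasFDerivAt g (fderiv ℝ (vertexShear γ v R θ₀) z - ContinuousLinearMap.id ℝ H) z :=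
    fun z => (hdiff z).hasFDerivAt.sub (hasFDerivAt_id z)
  have hbound : ∀ z ∈ (univ : Set H), ‖fderiv ℝ g z‖ ≤ c := fun z _ => by rw [(hgd z).fderiv]; exact hc z
  have h := (convex_univ).norm_image_sub_le_of_norm_fderiv_le (fun z _ => (hgd z).differentiableAt) hbound
    (mem_univ y) (mem_univ x)
  -- `g x − g y = (Θ x − Θ y) − (x − y)`
  have e : g x - g y = vertexShear γ v R θ₀ x - vertexShear γ v R θ₀ y - (x - y) := by
    simp only [hg]; abel
  rw [e] at h
  exact h

/-- **The vertex shear is a homeomorphism of the whole space** as soon as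
`‖D(vertexShear) − I‖ ≤ c < 1` (nontrivial `H`; Mathlib's `ApproximatesLinearOn.toHomeomorph`).
[folklore] -/
def vertexShearHomeomorph [CompleteSpace H] [Nontrivial H] (hR : 0 < R) (hγ : ∀ i, ContDiff ℝ ∞ (γ i))
    {c : ℝ≥0} (hc : ∀ z : H, ‖fderiv ℝ (vertexShear γ v R θ₀) z - ContinuousLinearMap.id ℝ H‖ ≤ c)
    (hc1 : c < 1) : H ≃ₜ H :=
  (approximatesLinearOn_vertexShear hR hγ hc).toHomeomorph _ (Or.inr (by
    have h : ‖((ContinuousLinearEquiv.refl ℝ H).symm : H →L[ℝ] H)‖₊ = 1 := by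
      rw [ContinuousLinearEquiv.refl_symm]
      exact Subtype.ext (by simp)
    rw [h, inv_one]; exact hc1))

/-- The homeomorphism is the vertex shear as a function (definitional). [folklore] -/
@[simp]
theorem coe_vertexShearHomeomorph [CompleteSpace H] [Nontrivial H] (hR : 0 < R) (hγ : ∀ i, ContDiff ℝ ∞ (γ i))
    {c : ℝ≥0} (hc : ∀ z : H, ‖fderiv ℝ (vertexShear γ v R θ₀) z - ContinuousLinearMap.id ℝ H‖ ≤ c)
    (hc1 : c < 1) : ⇑(vertexShearHomeomorph hR hγ hc hc1) = vertexShear γ v R θ₀ := rfl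

/-- **Every derivative of the vertex shear is invertible** when `‖D(vertexShear)(z) − I‖ < 1`
(Neumann series in the complete normed ring `H →L[ℝ] H`). [folklore] -/
theorem exists_hasFDerivAt_equiv_vertexShear [CompleteSpace H] (hR : 0 < R) (hγ : ∀ i, ContDiff ℝ ∞ (γ i))
    {z : H} (hc : ‖fderiv ℝ (vertexShear γ v R θ₀) z - ContinuousLinearMap.id ℝ H‖ < 1) :
    ∃ L : H ≃L[ℝ] H, HasFDerivAt (vertexShear γ v R θ₀) (L : H →L[ℝ] H) z := by
  set A := fderiv ℝ (vertexShear γ v R θ₀) z with hA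
  have hu : IsUnit A := by
    have h1 : ‖(1 : H →L[ℝ] H) - A‖ < 1 := by
      rw [← norm_neg, neg_sub]; exact hc
    have := (Units.oneSub ((1 : H →L[ℝ] H) - A) h1).isUnit
    rwa [Units.val_oneSub, sub_sub_cancel] at this
  refine ⟨ContinuousLinearEquiv.unitsEquiv ℝ H hu.unit, ?_⟩
  have hcoe : ((ContinuousLinearEquiv.unitsEquiv ℝ H hu.unit : H ≃L[ℝ] H) : H →L[ℝ] H) = A :=
    ContinuousLinearMap.ext fun x => by simp [ContinuousLinearEquiv.unitsEquiv_apply]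
  rw [hcoe]
  exact ((contDiff_vertexShear hR hγ).differentiable (by simp) z).hasFDerivAt

end Literature.Topology.FourManifolds
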